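import Summits.PneNP.PneNP.Theorems.ConvexRankGatesConvexGateBlindExactLiftingTriangleLineCover

/-!
# The triangle instance: the strict-rank jump in the LINE MODEL

Support file for crux `ConvexGateBlind` (stmt-PneNP-10680), line `xor-door-perfect-completeness`, open
stub `stub_exactLifting` (prover seat 0, session 20; memo ANALYSIS10; third of three files
`…TriangleLineVC` ⟵ `…TriangleLineCover` ⟵ this).

THEOREM (`triangle_line_nmf_bound`, registered). If `M_t − εJ = ∑_{l<R} u_l ⊗ v_l + ∑_{j<q} a_j ⊗ b_j`
with all factors `≥ 0`, `ε > 0`, every `v_l` supported inside ONE junta line and the `q` terms arbitrary, then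
`t³ ≤ 4·((⌊log₂ t⌋+1)(R + 3t²(q+1)) + 6t²)`; so `R ≥ t³/(4 log₂ t)(1 − o(1))` whenever `q = o(t/log t)`.
In the same model `ε = 0` costs `3t²` (junta lines) and every `ε ∈ (0,1]` admits `t³` (points): the exact
`0⁺`-jump `3t² → Θ̃(t³)`, uniformly in `ε`, by a scale-free argument (it does not see the size of the
coefficients, so it is not capped by the functional cap `…ExactLiftingFunctionalCap`).

PROOF. For each line `e` the level sets `U_e(x)` (`x` ranging over all colourings) form a positivity family of
`#asg⁻¹(e) + q + 1` functions on `Fin t` (`U12_eq_posSet`, generators `gen12`: assigned profiles, restricted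
free columns, the constant), hence have `≤ 2 t^{#asg⁻¹(e)+q+1} ≤ 2^{1 + (log₂ t + 1)(…)}` members
(`card_fam12_le`, Dudley + Sauer–Shelah from `…TriangleLineVC`). By confinement `U_e(x)` lies inside the colour
class of the third block, which for fixed colourings of the other two blocks is a uniformly random subset, so
the averaging lemma gives `∑_x #U_e(x) ≤ 8^t (k_e + 1)` (`sum_card_U12_le` &c.). Summing the cover
inequality over `x` and comparing with `∑_x #Mono_x = t³ 8^t/4` (`triangle_mono_count`) gives the bound, the
fibres of the assignment summing to `R` (`sum_card_fibres`).
-/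

set_option linter.dupNamespace false -- `Summit.PneNP.PneNP.…`: summit = sub-problem (D-0017)

namespace Summit.PneNP.PneNP.Theorems.XorDoor.TriLine

open Finset

noncomputable section

/-! ### The positivity families of a line and the averaging over colourings -/

section Families

variable {t R q : ℕ} (v : Fin R → Tri t → ℝ) (asg : Fin R → Line t) (ε : ℝ)
  (u : Col t → Fin R → ℝ) (α : Col t → Fin q → ℝ) (β : Fin q → Tri t → ℝ)

/-- generators of the `(a,b)`-line: assigned profiles, restricted free terms, the constant -/
def gen12 (a b : Fin t) : ({l // asg l = Sum.inl (a, b)} ⊕ Fin q ⊕ Unit) → Fin t → ℝ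
  | Sum.inl l => fun d => v l.1 (a, b, d)
  | Sum.inr (Sum.inl j) => fun d => β j (a, b, d)
  | Sum.inr (Sum.inr _) => fun _ => 1

/-- generators of the `(a,d)`-line -/
def gen13 (a d : Fin t) : ({l // asg l = Sum.inr (Sum.inl (a, d))} ⊕ Fin q ⊕ Unit) → Fin t → ℝ
  | Sum.inl l => fun b => v l.1 (a, b, d)
  | Sum.inr (Sum.inl j) => fun b => β j (a, b, d)
  | Sum.inr (Sum.inr _) => fun _ => 1

/-- generators of the `(b,d)`-line -/
def gen23 (b d : Fin t) : ({l // asg l = Sum.inr (Sum.inr (b, d))} ⊕ Fin q ⊕ Unit) → Fin t → ℝ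
  | Sum.inl l => fun a => v l.1 (a, b, d)
  | Sum.inr (Sum.inl j) => fun a => β j (a, b, d)
  | Sum.inr (Sum.inr _) => fun _ => 1

/-- the level set `U12` of the row `x` is a positivity set of the generators `gen12` -/
lemma U12_eq_posSet (x : Col t) (a b : Fin t) :
    U12 (v := v) (asg := asg) ε (u x) (α x) β a b
      = posSet fun d => ∑ i, (Sum.elim (fun l => u x l.1) (Sum.elim (fun j => α x j) fun _ => ε - 1) i)
          * gen12 v asg β a b i d := by
  unfold U12
  congr 1
  funext d
  have hsub : ∑ l : {l // asg l = Sum.inl (a, b)}, u x l.1 * v l.1 (a, b, d)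
      = ∑ l, if asg l = Sum.inl (a, b) then u x l * v l (a, b, d) else 0 := by
    rw [← Finset.sum_filter]
    exact (Finset.sum_subtype (univ.filter fun l => asg l = Sum.inl (a, b)) (by simp)
      (fun l => u x l * v l (a, b, d))).symm
  simp only [p12, thr, gen12, Fintype.sum_sum_type, Sum.elim_inl, Sum.elim_inr, Fintype.sum_unique,
    mul_one]
  rw [hsub]
  ring

end Families

section Families2

variable {t R q : ℕ} (v : Fin R → Tri t → ℝ) (asg : Fin R → Line t) (ε : ℝ)
  (u : Col t → Fin R → ℝ) (α : Col t → Fin q → ℝ) (β : Fin q → Tri t → ℝ)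

/-- the level set `U13` of the row `x` is a positivity set of the generators `gen13` -/
lemma U13_eq_posSet (x : Col t) (a d : Fin t) :
    U13 (v := v) (asg := asg) ε (u x) (α x) β a d
      = posSet fun b => ∑ i, (Sum.elim (fun l => u x l.1) (Sum.elim (fun j => α x j) fun _ => ε - 1) i)
          * gen13 v asg β a d i b := by
  unfold U13
  congr 1
  funext b
  have hsub : ∑ l : {l // asg l = Sum.inr (Sum.inl (a, d))}, u x l.1 * v l.1 (a, b, d)
      = ∑ l, if asg l = Sum.inr (Sum.inl (a, d)) then u x l * v l (a, b, d) else 0 := by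
    rw [← Finset.sum_filter]
    exact (Finset.sum_subtype (univ.filter fun l => asg l = Sum.inr (Sum.inl (a, d))) (by simp)
      (fun l => u x l * v l (a, b, d))).symm
  simp only [p13, thr, gen13, Fintype.sum_sum_type, Sum.elim_inl, Sum.elim_inr, Fintype.sum_unique,
    mul_one]
  rw [hsub]
  ring

/-- the level set `U23` of the row `x` is a positivity set of the generators `gen23` -/
lemma U23_eq_posSet (x : Col t) (b d : Fin t) :
    U23 (v := v) (asg := asg) ε (u x) (α x) β b d
      = posSet fun a => ∑ i, (Sum.elim (fun l => u x l.1) (Sum.elim (fun j => α x j) fun _ => ε - 1) i)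
          * gen23 v asg β b d i a := by
  unfold U23
  congr 1
  funext a
  have hsub : ∑ l : {l // asg l = Sum.inr (Sum.inr (b, d))}, u x l.1 * v l.1 (a, b, d)
      = ∑ l, if asg l = Sum.inr (Sum.inr (b, d)) then u x l * v l (a, b, d) else 0 := by
    rw [← Finset.sum_filter]
    exact (Finset.sum_subtype (univ.filter fun l => asg l = Sum.inr (Sum.inr (b, d))) (by simp)
      (fun l => u x l * v l (a, b, d))).symm
  simp only [p23, thr, gen23, Fintype.sum_sum_type, Sum.elim_inl, Sum.elim_inr, Fintype.sum_unique,
    mul_one]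
  rw [hsub]
  ring

/-- `2 t^D ≤ 2^(1 + (log₂ t + 1) D)` -/
lemma two_mul_pow_le_two_pow (t D : ℕ) : 2 * t ^ D ≤ 2 ^ (1 + (Nat.log 2 t + 1) * D) := by
  have ht : t ≤ 2 ^ (Nat.log 2 t + 1) := (Nat.lt_pow_succ_log_self (by norm_num) t).le
  calc 2 * t ^ D ≤ 2 * (2 ^ (Nat.log 2 t + 1)) ^ D := Nat.mul_le_mul_left 2 (Nat.pow_le_pow_left ht D)
    _ = 2 ^ (1 + (Nat.log 2 t + 1) * D) := by rw [← pow_mul, pow_add, pow_one]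

/-- size of the positivity family of the `(a,b)`-line -/
lemma card_fam12_le (ht : 2 ≤ t) (a b : Fin t) :
    #(univ.image fun x => U12 (v := v) (asg := asg) ε (u x) (α x) β a b)
      ≤ 2 ^ (1 + (Nat.log 2 t + 1) * (#(univ.filter fun l => asg l = Sum.inl (a, b)) + q + 1)) := by
  refine le_trans ?_ (two_mul_pow_le_two_pow t _)
  have h := card_posFamily_le_pow ht (gen12 v asg β a b)
    (Fam := univ.image fun x => U12 (v := v) (asg := asg) ε (u x) (α x) β a b) (fun U hU => by
      obtain ⟨x, _, rfl⟩ := mem_image.1 hU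
      exact ⟨_, U12_eq_posSet v asg ε u α β x a b⟩)
  simpa [Fintype.card_sum, Fintype.card_subtype, Fintype.card_fin, add_assoc] using h

/-- size of the positivity family of the `(a,d)`-line -/
lemma card_fam13_le (ht : 2 ≤ t) (a d : Fin t) :
    #(univ.image fun x => U13 (v := v) (asg := asg) ε (u x) (α x) β a d)
      ≤ 2 ^ (1 + (Nat.log 2 t + 1) * (#(univ.filter fun l => asg l = Sum.inr (Sum.inl (a, d))) + q + 1)) := by
  refine le_trans ?_ (two_mul_pow_le_two_pow t _)
  have h := card_posFamily_le_pow ht (gen13 v asg β a d)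
    (Fam := univ.image fun x => U13 (v := v) (asg := asg) ε (u x) (α x) β a d) (fun U hU => by
      obtain ⟨x, _, rfl⟩ := mem_image.1 hU
      exact ⟨_, U13_eq_posSet v asg ε u α β x a d⟩)
  simpa [Fintype.card_sum, Fintype.card_subtype, Fintype.card_fin, add_assoc] using h

/-- size of the positivity family of the `(b,d)`-line -/
lemma card_fam23_le (ht : 2 ≤ t) (b d : Fin t) :
    #(univ.image fun x => U23 (v := v) (asg := asg) ε (u x) (α x) β b d)
      ≤ 2 ^ (1 + (Nat.log 2 t + 1) * (#(univ.filter fun l => asg l = Sum.inr (Sum.inr (b, d))) + q + 1)) := by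
  refine le_trans ?_ (two_mul_pow_le_two_pow t _)
  have h := card_posFamily_le_pow ht (gen23 v asg β b d)
    (Fam := univ.image fun x => U23 (v := v) (asg := asg) ε (u x) (α x) β b d) (fun U hU => by
      obtain ⟨x, _, rfl⟩ := mem_image.1 hU
      exact ⟨_, U23_eq_posSet v asg ε u α β x b d⟩)
  simpa [Fintype.card_sum, Fintype.card_subtype, Fintype.card_fin, add_assoc] using h

variable {v asg ε u α β}

/-- AVERAGING over colourings, `(a,b)`-lines: the third vertex of a point of `U12` has the colour of `a`. -/
lemma sum_card_U12_le (hrow : ∀ x, RowFact v asg ε x (u x) (α x) β)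
    (hp13 : ∀ x a d b, 0 ≤ p13 v asg (u x) a d b) (hp23 : ∀ x b d a, 0 ≤ p23 v asg (u x) b d a)
    (a b : Fin t) {k : ℕ} (hk : #(univ.image fun x => U12 (v := v) (asg := asg) ε (u x) (α x) β a b) ≤ 2 ^ k) :
    ∑ x : Col t, #(U12 (v := v) (asg := asg) ε (u x) (α x) β a b) ≤ 2 ^ t * 2 ^ t * (2 ^ t * (k + 1)) := by
  set F := univ.image fun x => U12 (v := v) (asg := asg) ε (u x) (α x) β a b with hF
  have h1 : ∀ x : Col t, #(U12 (v := v) (asg := asg) ε (u x) (α x) β a b) ≤ maxIn F (cls x.2.2 (x.1 a)) :=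
    fun x => card_le_maxIn (mem_image_of_mem _ (mem_univ x)) fun d hd => by
      have hm := isMono_of_mem_U12 (hrow x) (hp13 x) (hp23 x) hd
      simpa [cls] using hm.2.symm
  calc ∑ x : Col t, #(U12 (v := v) (asg := asg) ε (u x) (α x) β a b)
      ≤ ∑ x : Col t, maxIn F (cls x.2.2 (x.1 a)) := sum_le_sum fun x _ => h1 x
    _ = ∑ x1 : Fin t → Bool, ∑ _x2 : Fin t → Bool, ∑ x3 : Fin t → Bool, maxIn F (cls x3 (x1 a)) := by
        simp only [Fintype.sum_prod_type]
    _ ≤ ∑ _x1 : Fin t → Bool, ∑ _x2 : Fin t → Bool, 2 ^ t * (k + 1) :=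
        sum_le_sum fun x1 _ => sum_le_sum fun _ _ => sum_maxIn_cls_le F hk (x1 a)
    _ = 2 ^ t * 2 ^ t * (2 ^ t * (k + 1)) := by simp; ring

/-- AVERAGING, `(a,d)`-lines: the middle vertex of a point of `U13` has the colour of `a`. -/
lemma sum_card_U13_le (hrow : ∀ x, RowFact v asg ε x (u x) (α x) β)
    (hp12 : ∀ x a b d, 0 ≤ p12 v asg (u x) a b d) (hp23 : ∀ x b d a, 0 ≤ p23 v asg (u x) b d a)
    (a d : Fin t) {k : ℕ} (hk : #(univ.image fun x => U13 (v := v) (asg := asg) ε (u x) (α x) β a d) ≤ 2 ^ k) :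
    ∑ x : Col t, #(U13 (v := v) (asg := asg) ε (u x) (α x) β a d) ≤ 2 ^ t * 2 ^ t * (2 ^ t * (k + 1)) := by
  set F := univ.image fun x => U13 (v := v) (asg := asg) ε (u x) (α x) β a d with hF
  have h1 : ∀ x : Col t, #(U13 (v := v) (asg := asg) ε (u x) (α x) β a d) ≤ maxIn F (cls x.2.1 (x.1 a)) :=
    fun x => card_le_maxIn (mem_image_of_mem _ (mem_univ x)) fun b hb => by
      have hm := isMono_of_mem_U13 (hrow x) (hp12 x) (hp23 x) hb
      simpa [cls] using hm.1.symm
  calc ∑ x : Col t, #(U13 (v := v) (asg := asg) ε (u x) (α x) β a d)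
      ≤ ∑ x : Col t, maxIn F (cls x.2.1 (x.1 a)) := sum_le_sum fun x _ => h1 x
    _ = ∑ x1 : Fin t → Bool, ∑ x2 : Fin t → Bool, ∑ _x3 : Fin t → Bool, maxIn F (cls x2 (x1 a)) := by
        simp only [Fintype.sum_prod_type]
    _ = ∑ x1 : Fin t → Bool, 2 ^ t * ∑ x2 : Fin t → Bool, maxIn F (cls x2 (x1 a)) := by
        simp [mul_sum]
    _ ≤ ∑ _x1 : Fin t → Bool, 2 ^ t * (2 ^ t * (k + 1)) :=
        sum_le_sum fun x1 _ => Nat.mul_le_mul_left _ (sum_maxIn_cls_le F hk (x1 a))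
    _ = 2 ^ t * 2 ^ t * (2 ^ t * (k + 1)) := by simp; ring

/-- AVERAGING, `(b,d)`-lines: the first vertex of a point of `U23` has the colour of `b`. -/
lemma sum_card_U23_le (hrow : ∀ x, RowFact v asg ε x (u x) (α x) β)
    (hp12 : ∀ x a b d, 0 ≤ p12 v asg (u x) a b d) (hp13 : ∀ x a d b, 0 ≤ p13 v asg (u x) a d b)
    (b d : Fin t) {k : ℕ} (hk : #(univ.image fun x => U23 (v := v) (asg := asg) ε (u x) (α x) β b d) ≤ 2 ^ k) :
    ∑ x : Col t, #(U23 (v := v) (asg := asg) ε (u x) (α x) β b d) ≤ 2 ^ t * 2 ^ t * (2 ^ t * (k + 1)) := by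
  set F := univ.image fun x => U23 (v := v) (asg := asg) ε (u x) (α x) β b d with hF
  have h1 : ∀ x : Col t, #(U23 (v := v) (asg := asg) ε (u x) (α x) β b d) ≤ maxIn F (cls x.1 (x.2.1 b)) :=
    fun x => card_le_maxIn (mem_image_of_mem _ (mem_univ x)) fun a ha => by
      have hm := isMono_of_mem_U23 (hrow x) (hp12 x) (hp13 x) ha
      simpa [cls] using hm.1
  calc ∑ x : Col t, #(U23 (v := v) (asg := asg) ε (u x) (α x) β b d)
      ≤ ∑ x : Col t, maxIn F (cls x.1 (x.2.1 b)) := sum_le_sum fun x _ => h1 x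
    _ = ∑ x1 : Fin t → Bool, ∑ x2 : Fin t → Bool, ∑ _x3 : Fin t → Bool, maxIn F (cls x1 (x2 b)) := by
        simp only [Fintype.sum_prod_type]
    _ = ∑ x2 : Fin t → Bool, 2 ^ t * ∑ x1 : Fin t → Bool, maxIn F (cls x1 (x2 b)) := by
        rw [sum_comm]
        simp [mul_sum]
    _ ≤ ∑ _x2 : Fin t → Bool, 2 ^ t * (2 ^ t * (k + 1)) :=
        sum_le_sum fun x2 _ => Nat.mul_le_mul_left _ (sum_maxIn_cls_le F hk (x2 b))
    _ = 2 ^ t * 2 ^ t * (2 ^ t * (k + 1)) := by simp; ring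

end Families2

/-! ### The theorem -/

/-- The assigned lines partition the line-supported terms. -/
lemma sum_card_fibres {t R : ℕ} (asg : Fin R → Line t) :
    ∑ ab : Fin t × Fin t, #(univ.filter fun l => asg l = Sum.inl ab)
      + ∑ ad : Fin t × Fin t, #(univ.filter fun l => asg l = Sum.inr (Sum.inl ad))
      + ∑ bd : Fin t × Fin t, #(univ.filter fun l => asg l = Sum.inr (Sum.inr bd)) = R := by
  classical
  have h := Finset.card_eq_sum_card_fiberwise (f := asg) (s := univ) (t := univ) fun _ _ => mem_univ _
  rw [card_univ, Fintype.card_fin, Fintype.sum_sum_type, Fintype.sum_sum_type] at h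
  rw [add_assoc]
  exact h.symm

/-- summing the per-line bound over the `t²` lines of one orientation -/
lemma sum_lineBound_eq {t : ℕ} (n q : ℕ) (c : Fin t × Fin t → ℕ) :
    ∑ e : Fin t × Fin t, 2 ^ t * 2 ^ t * (2 ^ t * ((1 + n * (c e + q + 1)) + 1))
      = 2 ^ t * 2 ^ t * 2 ^ t * (n * ∑ e, c e) + 2 ^ t * 2 ^ t * 2 ^ t * (t ^ 2 * (n * (q + 1) + 2)) := by
  have h : ∀ e, 2 ^ t * 2 ^ t * (2 ^ t * ((1 + n * (c e + q + 1)) + 1))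
      = 2 ^ t * 2 ^ t * 2 ^ t * (n * c e) + 2 ^ t * 2 ^ t * 2 ^ t * (n * (q + 1) + 2) := fun e => by ring
  simp only [h, sum_add_distrib, ← mul_sum, sum_const, card_univ, Fintype.card_prod, Fintype.card_fin,
    smul_eq_mul]
  ring

/-- **LINE-MODEL LOWER BOUND for the triangle instance** (prover seat 0, session 20; memo ANALYSIS10).
Let `M_t[x,w]` = number of monochromatic edges of the transversal triangle `w = (a,b,d)` of `K_{t,t,t}` under the
`2`-colouring `x` (`= 1 + 2·[x₁ a = x₂ b = x₃ d]`, seat 3's minimal instance; `rk₊ M_t ≤ 3t²` by the junta lines,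
`rk₊(M_t − J) = t³`). Suppose `M_t − εJ` (`ε > 0`) is written as a sum of `R` non-negative rank-one terms
`u_l ⊗ v_l` whose column factors `v_l` are each supported inside ONE junta line (`{(a,b,·)}`, `{(a,·,d)}` or
`{(·,b,d)}`), plus `q` arbitrary non-negative rank-one terms `a_j ⊗ b_j`. Then
`t³ ≤ 4·((⌊log₂ t⌋ + 1)·(R + 3t²(q+1)) + 6t²)`, i.e. `R ≥ t³/(4 log₂ t)·(1 − o(1))` as soon as `q = o(t / log t)`:
uniformly in `ε` (the argument is scale-free), whereas at `ε = 0` the same model needs only `3t²` terms and at every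
`ε ∈ (0,1]` it has a solution with `t³` terms (points). Proof: cover lemma + confinement (`card_mono_le`,
`isMono_of_mem_U12`), Dudley/Sauer–Shelah (`card_posFamily_le_pow`), averaging over all colourings
(`sum_maxIn_le`), and `∑_x #Mono_x = t³ 8^t / 4`. -/
theorem triangle_line_nmf_bound' (t R q : ℕ) (ht : 2 ≤ t) (ε : ℝ) (hε : 0 < ε)
    (u : Col t → Fin R → ℝ) (v : Fin R → Tri t → ℝ) (a : Col t → Fin q → ℝ) (b : Fin q → Tri t → ℝ)
    (hu : ∀ x l, 0 ≤ u x l) (hv : ∀ l w, 0 ≤ v l w) (ha : ∀ x j, 0 ≤ a x j) (hb : ∀ j w, 0 ≤ b j w)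
    (hline : ∀ l, (∃ a₀ b₀ : Fin t, ∀ w, v l w ≠ 0 → w.1 = a₀ ∧ w.2.1 = b₀) ∨
      (∃ a₀ d₀ : Fin t, ∀ w, v l w ≠ 0 → w.1 = a₀ ∧ w.2.2 = d₀) ∨
      (∃ b₀ d₀ : Fin t, ∀ w, v l w ≠ 0 → w.2.1 = b₀ ∧ w.2.2 = d₀))
    (hfact : ∀ x w, (monoCount x w : ℝ) - ε = ∑ l, u x l * v l w + ∑ j, a x j * b j w) :
    t ^ 3 ≤ 4 * ((Nat.log 2 t + 1) * (R + 3 * t ^ 2 * (q + 1)) + 6 * t ^ 2) := by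
  classical
  -- choose a line for every line-supported term
  have hex : ∀ l, ∃ L : Line t, OnLine (v l) L := by
    intro l
    rcases hline l with ⟨a₀, b₀, h⟩ | ⟨a₀, d₀, h⟩ | ⟨b₀, d₀, h⟩
    · exact ⟨Sum.inl (a₀, b₀), h⟩
    · exact ⟨Sum.inr (Sum.inl (a₀, d₀)), h⟩
    · exact ⟨Sum.inr (Sum.inr (b₀, d₀)), h⟩
  choose asg hasg using hex
  -- the row identities, split along lines, and the signs
  have hrow : ∀ x, RowFact v asg ε x (u x) (a x) b := by
    intro x a' b' d'
    rw [hfact x (a', b', d'), sum_eq_p12_add_p13_add_p23 hasg (u x) a' b' d']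
  have hp12 : ∀ x a' b' d', 0 ≤ p12 v asg (u x) a' b' d' := fun x a' b' d' =>
    sum_nonneg fun l _ => by
      split_ifs
      · exact mul_nonneg (hu x l) (hv l _)
      · exact le_rfl
  have hp13 : ∀ x a' d' b', 0 ≤ p13 v asg (u x) a' d' b' := fun x a' d' b' =>
    sum_nonneg fun l _ => by
      split_ifs
      · exact mul_nonneg (hu x l) (hv l _)
      · exact le_rfl
  have hp23 : ∀ x b' d' a', 0 ≤ p23 v asg (u x) b' d' a' := fun x b' d' a' =>
    sum_nonneg fun l _ => by
      split_ifs
      · exact mul_nonneg (hu x l) (hv l _)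
      · exact le_rfl
  have hfree : ∀ (x : Col t) (w : Tri t), 0 ≤ ∑ j, a x j * b j w := fun x w =>
    sum_nonneg fun j _ => mul_nonneg (ha x j) (hb j w)
  set n := Nat.log 2 t + 1 with hn
  -- fibre sizes of the assignment
  set c12 : Fin t × Fin t → ℕ := fun ab => #(univ.filter fun l => asg l = Sum.inl ab) with hc12
  set c13 : Fin t × Fin t → ℕ := fun ad => #(univ.filter fun l => asg l = Sum.inr (Sum.inl ad)) with hc13
  set c23 : Fin t × Fin t → ℕ := fun bd => #(univ.filter fun l => asg l = Sum.inr (Sum.inr bd)) with hc23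
  have hfib : ∑ e, c12 e + ∑ e, c13 e + ∑ e, c23 e = R := sum_card_fibres asg
  -- per-line averaged bounds
  have h12 : ∀ ab : Fin t × Fin t, ∑ x : Col t, #(U12 (v := v) (asg := asg) ε (u x) (a x) b ab.1 ab.2)
      ≤ 2 ^ t * 2 ^ t * (2 ^ t * ((1 + n * (c12 ab + q + 1)) + 1)) := fun ab =>
    sum_card_U12_le hrow hp13 hp23 ab.1 ab.2 (card_fam12_le v asg ε u a b ht ab.1 ab.2)
  have h13 : ∀ ad : Fin t × Fin t, ∑ x : Col t, #(U13 (v := v) (asg := asg) ε (u x) (a x) b ad.1 ad.2)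
      ≤ 2 ^ t * 2 ^ t * (2 ^ t * ((1 + n * (c13 ad + q + 1)) + 1)) := fun ad =>
    sum_card_U13_le hrow hp12 hp23 ad.1 ad.2 (card_fam13_le v asg ε u a b ht ad.1 ad.2)
  have h23 : ∀ bd : Fin t × Fin t, ∑ x : Col t, #(U23 (v := v) (asg := asg) ε (u x) (a x) b bd.1 bd.2)
      ≤ 2 ^ t * 2 ^ t * (2 ^ t * ((1 + n * (c23 bd + q + 1)) + 1)) := fun bd =>
    sum_card_U23_le hrow hp12 hp13 bd.1 bd.2 (card_fam23_le v asg ε u a b ht bd.1 bd.2)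
  -- summing the cover inequality over all colourings
  have hsum : ∑ x : Col t, #(univ.filter fun w : Tri t => IsMono x w.1 w.2.1 w.2.2)
      ≤ 2 ^ t * 2 ^ t * 2 ^ t * (n * (R + 3 * t ^ 2 * (q + 1)) + 6 * t ^ 2) := by
    calc ∑ x : Col t, #(univ.filter fun w : Tri t => IsMono x w.1 w.2.1 w.2.2)
        ≤ ∑ x : Col t, (∑ ab : Fin t × Fin t, #(U12 (v := v) (asg := asg) ε (u x) (a x) b ab.1 ab.2)
            + ∑ ad : Fin t × Fin t, #(U13 (v := v) (asg := asg) ε (u x) (a x) b ad.1 ad.2)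
            + ∑ bd : Fin t × Fin t, #(U23 (v := v) (asg := asg) ε (u x) (a x) b bd.1 bd.2)) :=
          sum_le_sum fun x _ => card_mono_le (hrow x) hε (hfree x)
      _ = ∑ ab : Fin t × Fin t, ∑ x : Col t, #(U12 (v := v) (asg := asg) ε (u x) (a x) b ab.1 ab.2)
            + ∑ ad : Fin t × Fin t, ∑ x : Col t, #(U13 (v := v) (asg := asg) ε (u x) (a x) b ad.1 ad.2)
            + ∑ bd : Fin t × Fin t, ∑ x : Col t, #(U23 (v := v) (asg := asg) ε (u x) (a x) b bd.1 bd.2) := by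
          rw [sum_add_distrib, sum_add_distrib, sum_comm]
          congr 1
          · congr 1
            exact sum_comm
          · exact sum_comm
      _ ≤ ∑ ab : Fin t × Fin t, 2 ^ t * 2 ^ t * (2 ^ t * ((1 + n * (c12 ab + q + 1)) + 1))
            + ∑ ad : Fin t × Fin t, 2 ^ t * 2 ^ t * (2 ^ t * ((1 + n * (c13 ad + q + 1)) + 1))
            + ∑ bd : Fin t × Fin t, 2 ^ t * 2 ^ t * (2 ^ t * ((1 + n * (c23 bd + q + 1)) + 1)) :=
          add_le_add (add_le_add (sum_le_sum fun e _ => h12 e) (sum_le_sum fun e _ => h13 e))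
            (sum_le_sum fun e _ => h23 e)
      _ = 2 ^ t * 2 ^ t * 2 ^ t * (n * (R + 3 * t ^ 2 * (q + 1)) + 6 * t ^ 2) := by
          rw [sum_lineBound_eq, sum_lineBound_eq, sum_lineBound_eq, ← hfib]
          ring
  -- compare with the exact count of monochromatic triangles
  have hmono := four_mul_sum_card_mono (t := t)
  have hpos : 0 < 2 ^ t * 2 ^ t * 2 ^ t := by positivity
  have key : 2 ^ t * 2 ^ t * 2 ^ t * t ^ 3
      ≤ 2 ^ t * 2 ^ t * 2 ^ t * (4 * (n * (R + 3 * t ^ 2 * (q + 1)) + 6 * t ^ 2)) := by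
    calc 2 ^ t * 2 ^ t * 2 ^ t * t ^ 3
        = 4 * ∑ x : Col t, #(univ.filter fun w : Tri t => IsMono x w.1 w.2.1 w.2.2) := by rw [hmono]; ring
      _ ≤ 4 * (2 ^ t * 2 ^ t * 2 ^ t * (n * (R + 3 * t ^ 2 * (q + 1)) + 6 * t ^ 2)) :=
          Nat.mul_le_mul_left 4 hsum
      _ = 2 ^ t * 2 ^ t * 2 ^ t * (4 * (n * (R + 3 * t ^ 2 * (q + 1)) + 6 * t ^ 2)) := by ring
  exact Nat.le_of_mul_le_mul_left key hpos

/-- **LINE-MODEL LOWER BOUND for the triangle instance** — registered sub-goal `triangle_line_nmf_bound` of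
stmt-PneNP-10680, verbatim signature with the instance inlined (see `triangle_line_nmf_bound'`): for every
decomposition of `M_t − εJ` (`ε > 0`) into `R` non-negative rank-one terms with column factors supported on junta
lines plus `q` arbitrary non-negative rank-one terms, `t³ ≤ 4((⌊log₂ t⌋+1)(R + 3t²(q+1)) + 6t²)`. -/
theorem triangle_line_nmf_bound :
    ∀ (t R q : ℕ), 2 ≤ t → ∀ (ε : ℝ), 0 < ε → ∀ (u : (Fin t → Bool) × (Fin t → Bool) × (Fin t → Bool) → Fin R
    → ℝ) (v : Fin R → Fin t × Fin t × Fin t → ℝ) (a : (Fin t → Bool) × (Fin t → Bool) × (Fin t → Bool) → Fin q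
    → ℝ) (b : Fin q → Fin t × Fin t × Fin t → ℝ), (∀ x l, 0 ≤ u x l) → (∀ l w, 0 ≤ v l w) → (∀ x j, 0 ≤ a x j)
    → (∀ j w, 0 ≤ b j w) → (∀ l, (∃ a₀ b₀ : Fin t, ∀ w, v l w ≠ 0 → w.1 = a₀ ∧ w.2.1 = b₀) ∨ (∃ a₀ d₀ : Fin t,
    ∀ w, v l w ≠ 0 → w.1 = a₀ ∧ w.2.2 = d₀) ∨ (∃ b₀ d₀ : Fin t, ∀ w, v l w ≠ 0 → w.2.1 = b₀ ∧ w.2.2 = d₀)) →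
    (∀ x w, (((if x.1 w.1 = x.2.1 w.2.1 then 1 else 0) + (if x.1 w.1 = x.2.2 w.2.2 then 1 else 0) + (if x.2.1
    w.2.1 = x.2.2 w.2.2 then 1 else 0) : ℕ) : ℝ) - ε = ∑ l, u x l * v l w + ∑ j, a x j * b j w) →
    t ^ 3 ≤ 4 * ((Nat.log 2 t + 1) * (R + 3 * t ^ 2 * (q + 1)) + 6 * t ^ 2) :=
  fun t R q ht ε hε u v a b hu hv ha hb hline hfact =>
    triangle_line_nmf_bound' t R q ht ε hε u v a b hu hv ha hb hline fun x w => by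
      simpa [monoCount] using hfact x w

end

end Summit.PneNP.PneNP.Theorems.XorDoor.TriLine
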